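import Literature.NumberTheory.Automorphic.Liu2021.Def45AsPrinted
import Literature.NumberTheory.ComplexMultiplication.ReflexNormDeterminant
import HarnessLib

/-!
# [Liu 2021] Definition 4.5 (2), fourth bullet — the `r_μ` normalisation at EVERY face of a Galois CM field

Y. Liu, *Fourier–Jacobi cycles and arithmetic relative trace formula*, Camb. J. Math. **9** (2021) = arXiv:2102.11518
[Liu2021]; TeX source `FJcycle.tex` (md5 `6db49a74122d…`), §4.1, Definition 4.5 (2) fourth bullet (l. 1957) and the
proof of Prop. 4.6 (1), l. 1982 «The existence of `r_μ` is obvious».  Red-team WATCH W1, r-half (pub-hodgecm2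
`HOME/pinning/HCMISOG-TABLE.md` sub-row (CP-S4c-P); s2crux-idea-1's `ROUTES.md` §18 (v12.6), in particular §18.0 (v) /
§18.4 (v′) «non-primitive faces with `E ⊄ M_μ`: NOT decided»).

AS PRINTED (l. 1957), VERBATIM: «• `r_μ : M_μ ⊗_ℚ E → H_1^{dR}(A_μ/E)` is an isomorphism of `M_μ ⊗_ℚ E`-modules satisfying
that there exist an element `β ∈ M_μ` and an isomorphism `c : H^{dR}_{2 dim A_μ}(A_μ/E) → E` of `E`-modules, such that
for every `x, y ∈ M_μ ⊗_ℚ E`, we have `c(⟨r_μ(x), r_μ(y)⟩_λ) = Tr_{M_μ ⊗_ℚ E/E}(x β ȳ)`».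

## The question and what this file decides

Write `K = M_μ` (a CM field, tree `IsConjugateSymplectic.isCMField_muAlgValueField`), `ρ` its complex conjugation,
`L = K ⊗_ℚ E`, `x ↦ x̄ = (ρ ⊗ 1)(x)`.  Granting the two CARRIER-level facts behind «obvious» — (i) `H_1^{dR}(A_μ/E)` is
free of rank one over `L`; (ii) for a generator `ω₀` and any `c`, `(x, y) ↦ c⟨x ω₀, y ω₀⟩_λ = Tr_{L/E}(x β₀ ȳ)` for a
unit `β₀ ∈ L` with `β̄₀ = -β₀` (perfectness, `E`-bilinearity, alternation and the Rosati relation of bullet 3) — the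
printed `r_μ` exists iff `β₀ = (β ⊗ 1) · a · ā` for some `β ∈ K` (necessarily `ρ β = -β`), `a ∈ L^×` (then
`r_μ(x) := x a⁻¹ ω₀`); equivalently iff the HERMITIAN unit `β₀ (β ⊗ 1)⁻¹` is a norm `a ā` — an obstruction class in
`T^×/(N_{L/T} L^× · K⁺^× · E^×)`, `T = K⁺ ⊗_ℚ E` (ROUTES §18 (2)(iii)).  [The tree has no algebraic de Rham homology over a
number field, so (i)–(ii) and `r_μ` itself are not objects here; the token `R` of `Def45.PolDR σ hμ R` stays DECLARED.]

THIS FILE PROVES, as pure algebra, that the obstruction VANISHES IDENTICALLY whenever `E/ℚ` is normal and receives a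
`ρ`-stable subfield `M' ⊆ K` on which `ρ ≠ 1` (§1), and that Liu's data meet this hypothesis at EVERY conjugate
symplectic `μ` of a CM field `E = F` GALOIS over `ℚ` (§2), with `M' = M'_μ` the reflex field: `M'_μ ⊆ M_μ` (l. 1928, tree
`traceField_le_muAlgValueField`), `M'_μ` is a CM field (tree `isCMField_traceField`), and `M'_μ ⊆ ι₁(F)` because `F` is
Galois (tree `traceField_le_fieldRange`).  Mechanism: `M' ⊗_ℚ E ≅ ∏_{g : M' → E} E` (Lagrange elements; `#Hom(M', E) =
[M' : ℚ]` since `E` is normal and receives `M'`), on which `c ⊗ 1` (`c = ρ|_{M'}`) permutes the factors by the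
FIXED-POINT-FREE involution `g ↦ g ∘ c`; so `M' ⊗ E` — hence `K ⊗ E` — contains an idempotent `ε` with `ε + ε̄ = 1`, and
then every Hermitian `h` is the norm of `a := ε h + ε̄`: `a ā = (ε h + ε̄)(ε̄ h + ε) = (ε + ε̄) h = h`.  No condition
«`E ↪ M_μ`» (ROUTES §18.4 (iv′), the primitive faces) is needed: §18.4 (v′) is decided POSITIVELY for every face of a
Galois CM field — in particular for every face `(F, ι₁, Φ)` admitted by the cells' END displays (`IsGalois ℚ F`).
For `E/ℚ` NOT normal the hypothesis of §1 can fail (inert factors of `K⁺ ⊗ E` occur) and nothing is claimed.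

* §1 (private helpers, inlined tonight): `M' ⊗_ℚ E ≅ ∏_{g : M' →ₐ E} E` for `E/ℚ` normal receiving `M'`; the idempotent
  `ε` with `ε + (c ⊗ 1) ε = 1`; every `(ρ ⊗ 1)`-fixed `h ∈ K ⊗_ℚ E` is `a · (ρ ⊗ 1) a` for any commutative `ℚ`-algebra `K`
  receiving `M'` compatibly.  SEE ALSO the general-algebra layer of b25 (same identity found independently; pub-hodgecm2
  lead ruling HOME/INBOX l.7635, one headline — two layers; re-homed to the cells' tree, l.7670, namespace
  `Summit.HodgeConjecture.CorCM.RMuNorm`): `Summits/HodgeConjecture/CorCM/RMuNormFixedUnits.lean` (involution-fixed units are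
  norms, given an idempotent `f` with `ρ f = 1 - f`), `Summits/HodgeConjecture/CorCM/RMuNormOddUnit.lean` (the supplier over
  any base field, via Dedekind independence), `Summits/HodgeConjecture/CorCM/RMuNormHermitianUnits.lean` (Hermitian units of
  `K ⊗_F E` are norms).  A Literature file cannot import those, so §1 stays inlined here.  THIS file states the
  [Liu2021]-level reading only:
* §2 at Liu's data (`K = M_μ = muAlgValueField F μ ⊆ ℂ`, `ρ` = complex conjugation, `M' = M'_μ = traceField Φ_μ`,
  `E = F` Galois CM, `μ` ANY conjugate symplectic character): `Def45.exists_conj_algHom_muAlgValueField` (non-vacuity: such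
  a `ρ` exists), `Def45.exists_mul_map_eq_muAlgValueField` (every Hermitian element of `M_μ ⊗_ℚ F` is a norm),
  `Def45.exists_eq_tmul_mul_mul_map_muAlgValueField` (the printed shape: every anti-invariant unit `β₀` is
  `(β ⊗ 1) · a · ā` for EVERY prescribed `β ∈ M_μ` with `ρ β = -β`, `β ≠ 0`, `a` a unit).

HONEST SCOPE.  Nothing here constructs `H_1^{dR}(A_μ/E)`, `r_μ`, Liu's `X_K`, `A_K`, `Ω(μ)`, or touches `hM`; no END
display binder is discharged by this file (it supplies the mathematics under which «`R := PUnit` because `r_μ` exists»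
would be honest at every face, the decision being the owners' and the red team's); HC_CM is NOT proved.  No new named
fact (D-0026 debt 0): every step rests on Mathlib and tree THEOREMS.  Companion (special case `M' = E`, i.e. `E ↪ M_μ`):
item6-p1's unfiled `exists_beta_of_split_galois` (ROUTES §18.4 (iv′)).

References: [Liu2021] Y. Liu, Camb. J. Math. 9 (2021) = arXiv:2102.11518 — §4.1 l. 1928, Def. 4.5 (2) fourth bullet
(TeX l. 1957), proof of Prop. 4.6 (1) (l. 1982); [Shimura1998] G. Shimura, *Abelian Varieties with Complex Multiplication
and Modular Functions* (1998), §8.3 Prop. 28 (the reflex field), §18.2 Lemma (CM subfields of `ℂ`).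
-/

set_option autoImplicit false

noncomputable section

open scoped TensorProduct ComplexConjugate
open Module NumberField

namespace Literature.NumberTheory.Automorphic.Liu2021.Def45

/-! ## §1 Pure algebra: the norm lemma for `K ⊗_ℚ E`, `E/ℚ` normal receiving a `ρ`-moved subfield of `K` -/

section Algebra

variable {M E : Type} [Field M] [Field E] [Algebra ℚ M] [Algebra ℚ E]
  [FiniteDimensional ℚ M] [FiniteDimensional ℚ E]

/-- **`M' ⊗_ℚ E ≅ ∏_{g : M' → E} E`** for a finite extension `M'/ℚ` and a finite NORMAL `E/ℚ` receiving `M'`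
(`jE : M' → E`): the algebra map `m ⊗ e ↦ (g(m) e)_g` is bijective — surjective by Lagrange elements separating the
finitely many embeddings, injective by the dimension count `#Hom_ℚ(M', E) = [M' : ℚ]` (every minimal polynomial of `M'`
has a root in `E` along `jE`, hence splits in the normal `E`; `AlgHom.card_of_splits`).  The mechanism behind the
vanishing of the `r_μ` obstruction. [cite: Liu2021, Def. 4.5 (2) fourth bullet (TeX l. 1957)] -/
private theorem algHomPi_bijective [Normal ℚ E] (jE : M →ₐ[ℚ] E) :
    Function.Bijective
      (AlgHom.pi fun g : M →ₐ[ℚ] E => Algebra.TensorProduct.productMap g (AlgHom.id ℚ E) :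
        M ⊗[ℚ] E →ₐ[ℚ] ((M →ₐ[ℚ] E) → E)) := by
  classical
  set ψ : (M →ₐ[ℚ] E) → (M ⊗[ℚ] E →ₐ[ℚ] E) := fun g =>
    Algebra.TensorProduct.productMap g (AlgHom.id ℚ E) with hψ_def
  set Ψ : M ⊗[ℚ] E →ₐ[ℚ] ((M →ₐ[ℚ] E) → E) := AlgHom.pi ψ with hΨ_def
  have hΨ : ∀ z g, Ψ z g = ψ g z := fun z g => AlgHom.pi_apply ψ z g
  have hψ_tmul : ∀ g (m : M) (e : E), ψ g (m ⊗ₜ[ℚ] e) = g m * e := fun g m e => by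
    simp [hψ_def, Algebra.TensorProduct.productMap_apply_tmul]
  -- separating elements and Lagrange elements
  have hsep : ∀ g g' : M →ₐ[ℚ] E, g ≠ g' → ∃ m, g m ≠ g' m := by
    intro g g' h
    by_contra hh
    push Not at hh
    exact h (AlgHom.ext hh)
  let d : (M →ₐ[ℚ] E) → (M →ₐ[ℚ] E) → M := fun g g' =>
    if h : g ≠ g' then Classical.choose (hsep g g' h) else 0
  have hd : ∀ g g' : M →ₐ[ℚ] E, g ≠ g' → g (d g g') - g' (d g g') ≠ 0 := by
    intro g g' h
    have h1 : g (d g g') ≠ g' (d g g') := by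
      simp only [d, dif_pos h]
      exact Classical.choose_spec (hsep g g' h)
    exact sub_ne_zero.mpr h1
  let L : (M →ₐ[ℚ] E) → M ⊗[ℚ] E := fun g₀ =>
    ∏ g ∈ Finset.univ.erase g₀,
      ((1 : M) ⊗ₜ[ℚ] (g₀ (d g₀ g) - g (d g₀ g))⁻¹) * (d g₀ g ⊗ₜ[ℚ] (1 : E) - (1 : M) ⊗ₜ[ℚ] g (d g₀ g))
  have hL_factor : ∀ g' g₀ g : M →ₐ[ℚ] E,
      ψ g' (((1 : M) ⊗ₜ[ℚ] (g₀ (d g₀ g) - g (d g₀ g))⁻¹) *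
        (d g₀ g ⊗ₜ[ℚ] (1 : E) - (1 : M) ⊗ₜ[ℚ] g (d g₀ g))) =
        (g₀ (d g₀ g) - g (d g₀ g))⁻¹ * (g' (d g₀ g) - g (d g₀ g)) := by
    intro g' g₀ g
    rw [map_mul, map_sub, hψ_tmul, hψ_tmul, hψ_tmul]
    simp
  have hL_self : ∀ g₀ : M →ₐ[ℚ] E, ψ g₀ (L g₀) = 1 := by
    intro g₀
    simp only [L, map_prod]
    refine Finset.prod_eq_one fun g hg => ?_
    rw [hL_factor]
    exact inv_mul_cancel₀ (hd g₀ g (Finset.ne_of_mem_erase hg).symm)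
  have hL_other : ∀ g₀ g' : M →ₐ[ℚ] E, g' ≠ g₀ → ψ g' (L g₀) = 0 := by
    intro g₀ g' hne
    simp only [L, map_prod]
    refine Finset.prod_eq_zero (Finset.mem_erase.mpr ⟨hne, Finset.mem_univ _⟩) ?_
    rw [hL_factor, sub_self, mul_zero]
  have hΨL : ∀ g₀ g' : M →ₐ[ℚ] E, Ψ (L g₀) g' = if g' = g₀ then (1 : E) else 0 := by
    intro g₀ g'
    rw [hΨ]
    split_ifs with h
    · rw [h]; exact hL_self g₀
    · exact hL_other g₀ g' h
  -- surjective (Lagrange)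
  have hsurj : Function.Surjective Ψ := by
    intro w
    refine ⟨∑ g₀, ((1 : M) ⊗ₜ[ℚ] w g₀) * L g₀, ?_⟩
    funext g'
    rw [hΨ, map_sum]
    simp_rw [map_mul, ← hΨ, hΨL, hΨ, hψ_tmul, map_one, one_mul, mul_ite, mul_one, mul_zero]
    simp
  -- injective (dimension count)
  have hcard : Fintype.card (M →ₐ[ℚ] E) = finrank ℚ M := by
    refine AlgHom.card_of_splits ℚ M E fun x => ?_
    rw [← minpoly.algHom_eq jE jE.toRingHom.injective x]
    exact Normal.splits inferInstance (jE x)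
  have hdim : finrank ℚ (M ⊗[ℚ] E) = finrank ℚ ((M →ₐ[ℚ] E) → E) := by
    rw [finrank_tensorProduct, finrank_pi_fintype, Finset.sum_const, Finset.card_univ, hcard,
      smul_eq_mul]
  have hinj : Function.Injective Ψ :=
    (LinearMap.injective_iff_surjective_of_finrank_eq_finrank hdim (f := Ψ.toLinearMap)).mpr hsurj
  exact ⟨hinj, hsurj⟩

/-- **The idempotent.**  Let `c : M' → M'` be an involutive `ℚ`-algebra endomorphism moving some element, and `E/ℚ`
finite normal receiving `M'`.  Then `M' ⊗_ℚ E` contains an idempotent `ε` with `ε + (c ⊗ 1) ε = 1`: under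
`M' ⊗_ℚ E ≅ ∏_{g : M' → E} E` (`algHomPi_bijective`) the automorphism `c ⊗ 1` becomes `(y_g)_g ↦ (y_{g ∘ c})_g`, and
`g ↦ g ∘ c` is a fixed-point-free involution of the finite set `Hom_ℚ(M', E)` (`g ∘ c = g` would force `c = 1`, `g` being
injective), so the indicator of a system of representatives of its orbits is the required `ε`.
[cite: Liu2021, Def. 4.5 (2) fourth bullet (TeX l. 1957)] -/
private theorem exists_idempotent_add_map_eq_one [Normal ℚ E] (jE : M →ₐ[ℚ] E) (c : M →ₐ[ℚ] M)
    (hc2 : ∀ m, c (c m) = m) (hc : ∃ m, c m ≠ m) :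
    ∃ ε : M ⊗[ℚ] E, ε * ε = ε ∧ ε + Algebra.TensorProduct.map c (AlgHom.id ℚ E) ε = 1 := by
  classical
  set ψ : (M →ₐ[ℚ] E) → (M ⊗[ℚ] E →ₐ[ℚ] E) := fun g =>
    Algebra.TensorProduct.productMap g (AlgHom.id ℚ E) with hψ_def
  set Ψ : M ⊗[ℚ] E →ₐ[ℚ] ((M →ₐ[ℚ] E) → E) := AlgHom.pi ψ with hΨ_def
  have hΨ : ∀ z g, Ψ z g = ψ g z := fun z g => AlgHom.pi_apply ψ z g
  obtain ⟨hinj, hsurj⟩ : Function.Bijective Ψ := algHomPi_bijective jE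
  set c' : M ⊗[ℚ] E →ₐ[ℚ] M ⊗[ℚ] E := Algebra.TensorProduct.map c (AlgHom.id ℚ E) with hc'_def
  -- `Ψ` intertwines `c ⊗ 1` with the translation `g ↦ g ∘ c`
  have H : ∀ z g, ψ g (c' z) = ψ (g.comp c) z := by
    intro z g
    have : (ψ g).comp c' = ψ (g.comp c) := by
      apply Algebra.TensorProduct.ext'
      intro a b
      simp [hψ_def, hc'_def, Algebra.TensorProduct.productMap_apply_tmul]
    exact congrArg (fun f : M ⊗[ℚ] E →ₐ[ℚ] E => f z) this
  -- `g ↦ g ∘ c` is a fixed-point-free involution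
  have hcc : ∀ g : M →ₐ[ℚ] E, (g.comp c).comp c = g := fun g => AlgHom.ext fun m => by
    simp [hc2]
  have hcne : ∀ g : M →ₐ[ℚ] E, g.comp c ≠ g := by
    intro g h
    obtain ⟨m, hm⟩ := hc
    apply hm
    exact g.toRingHom.injective (by simpa using congrArg (fun f : M →ₐ[ℚ] E => f m) h)
  -- representatives of the orbits `{g, g ∘ c}`
  let ord := Fintype.equivFin (M →ₐ[ℚ] E)
  let S : (M →ₐ[ℚ] E) → Prop := fun g => ord g < ord (g.comp c)
  have hS : ∀ g, S (g.comp c) ↔ ¬ S g := by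
    intro g
    simp only [S, hcc, not_lt]
    constructor
    · exact fun h => le_of_lt h
    · intro h
      exact lt_of_le_of_ne h fun e => hcne g (ord.injective e)
  obtain ⟨ε, hε⟩ := hsurj fun g => if S g then 1 else 0
  refine ⟨ε, hinj ?_, hinj ?_⟩
  · funext g
    rw [map_mul, Pi.mul_apply, hε]
    dsimp only
    split_ifs <;> simp
  · funext g
    rw [map_add, map_one, Pi.add_apply, Pi.one_apply, hΨ ε g, hΨ (c' ε) g, H ε g, ← hΨ, ← hΨ, hε]
    dsimp only
    by_cases hg : S g
    · have : ¬ S (g.comp c) := fun h => ((hS g).mp h) hg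
      rw [if_pos hg, if_neg this, add_zero]
    · have : S (g.comp c) := (hS g).mpr hg
      rw [if_neg hg, if_pos this, zero_add]

variable {K : Type} [CommRing K] [Algebra ℚ K]

/-- **The norm lemma.**  Let `K` be a commutative `ℚ`-algebra with an endomorphism `ρ`, receiving `M'` along `jK` with
`ρ ∘ jK = jK ∘ c` (`c` an involution of `M'` moving some element), and `E/ℚ` finite normal receiving `M'`.  Then EVERY
`(ρ ⊗ 1)`-fixed element `h ∈ K ⊗_ℚ E` is a norm: `h = a · (ρ ⊗ 1) a`.  Proof: push the idempotent `ε` of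
`exists_idempotent_add_map_eq_one` into `K ⊗ E` (`e + ē = 1`, `e² = e`, and the conjugate of `ē` is `e` again) and take
`a := e h + ē`; then `a ā = (e h + ē)(ē h + e) = (e + ē) h = h`.  For `K = M_μ`, `E` Liu's CM field: the Hermitian unit
`β₀ (β ⊗ 1)⁻¹` measuring the `r_μ` normalisation is a norm — no obstruction. [cite: Liu2021, Def. 4.5 (2) fourth bullet
(TeX l. 1957) and proof of Prop. 4.6 (1) (l. 1982)] -/
private theorem exists_mul_map_eq_of_map_eq [Normal ℚ E] (jE : M →ₐ[ℚ] E) (c : M →ₐ[ℚ] M)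
    (hc2 : ∀ m, c (c m) = m) (hc : ∃ m, c m ≠ m) (ρ : K →ₐ[ℚ] K) (jK : M →ₐ[ℚ] K)
    (hρ : ∀ m, ρ (jK m) = jK (c m)) (h : K ⊗[ℚ] E)
    (hh : Algebra.TensorProduct.map ρ (AlgHom.id ℚ E) h = h) :
    ∃ a : K ⊗[ℚ] E, a * Algebra.TensorProduct.map ρ (AlgHom.id ℚ E) a = h := by
  obtain ⟨ε, hε2, hε1⟩ := exists_idempotent_add_map_eq_one jE c hc2 hc
  set bar : K ⊗[ℚ] E →ₐ[ℚ] K ⊗[ℚ] E := Algebra.TensorProduct.map ρ (AlgHom.id ℚ E) with hbar_def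
  set j : M ⊗[ℚ] E →ₐ[ℚ] K ⊗[ℚ] E := Algebra.TensorProduct.map jK (AlgHom.id ℚ E) with hj_def
  -- `bar ∘ j = j ∘ (c ⊗ 1)`
  have hcomm : ∀ z, bar (j z) = j (Algebra.TensorProduct.map c (AlgHom.id ℚ E) z) := by
    intro z
    have h1 : bar.comp j = j.comp (Algebra.TensorProduct.map c (AlgHom.id ℚ E)) := by
      rw [hbar_def, hj_def, ← Algebra.TensorProduct.map_comp, ← Algebra.TensorProduct.map_comp]
      congr 1
      exact AlgHom.ext hρ
    exact congrArg (fun f : M ⊗[ℚ] E →ₐ[ℚ] K ⊗[ℚ] E => f z) h1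
  -- `c ⊗ 1` is an involution
  have hcc' : ∀ z : M ⊗[ℚ] E, Algebra.TensorProduct.map c (AlgHom.id ℚ E)
      (Algebra.TensorProduct.map c (AlgHom.id ℚ E) z) = z := by
    intro z
    rw [← AlgHom.comp_apply, ← Algebra.TensorProduct.map_comp,
      show c.comp c = AlgHom.id ℚ M from AlgHom.ext hc2, AlgHom.id_comp, Algebra.TensorProduct.map_id,
      AlgHom.id_apply]
  -- the idempotent `e = j ε` of `K ⊗ E`: `e² = e`, `ē = 1 - e`, and the conjugate of `ē` is `e`
  have he2 : j ε * j ε = j ε := by rw [← map_mul, hε2]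
  have he1 : j ε + bar (j ε) = 1 := by rw [hcomm, ← map_add, hε1, map_one]
  have hbe : bar (j ε) = 1 - j ε := by rw [← he1]; ring
  have hbbe : bar (bar (j ε)) = j ε := by rw [hcomm, hcomm, hcc']
  refine ⟨j ε * h + bar (j ε), ?_⟩
  rw [map_add, map_mul, hh, hbbe, hbe]
  linear_combination (-(h - 1) ^ 2) * he2

end Algebra

/-! ## §2 Liu's data: `K = M_μ ⊆ ℂ`, `ρ` = complex conjugation, `E = F` a CM field Galois over `ℚ` — EVERY face -/

section Liu

open Literature.NumberTheory.ComplexMultiplication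
open Literature.NumberTheory.Automorphic.IdeleClassGroup

variable {F : Type} [Field F] [NumberField F] [IsCMField F] {μ : IdeleClassGroup F →ₜ* Circle}

/-- **Non-vacuity of the `ρ` of §2**: complex conjugation of `ℂ` restricts to a `ℚ`-algebra endomorphism of Liu's
`M_μ ⊆ ℂ` (a CM field, tree `IsConjugateSymplectic.isCMField_muAlgValueField`; Mathlib `IsCMField.complexConj`).
[cite: Liu2021, §4.1 (TeX l. 1928) and Def. 4.5 (2) (l. 1957)] [cite: Shimura1998, §18.2 Lemma (ii)] -/
theorem exists_conj_algHom_muAlgValueField (hμ : IdeleClassGroup.IsConjugateSymplectic F μ) :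
    ∃ ρ : muAlgValueField F μ →ₐ[ℚ] muAlgValueField F μ,
      ∀ x, ((ρ x : muAlgValueField F μ) : ℂ) = conj (x : ℂ) := by
  haveI := hμ.numberField_muAlgValueField
  haveI := hμ.isCMField_muAlgValueField
  refine ⟨((IsCMField.complexConj (muAlgValueField F μ) : muAlgValueField F μ ≃ₐ[maximalRealSubfield _]
      muAlgValueField F μ) : muAlgValueField F μ →+* muAlgValueField F μ).toRatAlgHom, fun x => ?_⟩
  exact IsCMField.complexEmbedding_complexConj (muAlgValueField F μ) (muAlgValueField F μ).subtype x

/-- **[Liu2021, Def. 4.5 (2) fourth bullet] — the `r_μ` obstruction vanishes at EVERY face of a Galois CM field.**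
For `F` a CM field Galois over `ℚ`, `μ` ANY conjugate symplectic automorphic character of `F` (any CM type `Φ_μ`,
primitive or not), `K = M_μ ⊆ ℂ` and `ρ` any `ℚ`-algebra endomorphism of `M_μ` inducing complex conjugation: every
`(ρ ⊗ 1)`-fixed `h ∈ M_μ ⊗_ℚ F` is a norm `a · (ρ ⊗ 1) a`.  Instance of §1 with `M' = M'_μ = traceField Φ_μ` (a CM field,
`isCMField_traceField`; `M'_μ ⊆ M_μ`, `traceField_le_muAlgValueField`, l. 1928; `M'_μ ⊆ ι₁(F)` for any complex embedding
`ι₁` since `F/ℚ` is Galois, `traceField_le_fieldRange`).  Decides ROUTES §18.4 (v′) for the cells: given the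
carrier-level (i) rank-one freeness of `H_1^{dR}(A_μ/E)` and (ii) trace-form shape of `⟨ , ⟩_λ`, the printed `r_μ`
exists for every `(A_μ, i_μ, λ_μ)` satisfying bullets 1–3, at every face. [cite: Liu2021, Def. 4.5 (2) fourth bullet
(TeX l. 1957) and proof of Prop. 4.6 (1) (l. 1982)] [cite: Shimura1998, §8.3 Prop. 28 and §18.2 Lemma (ii)] -/
theorem exists_mul_map_eq_muAlgValueField [IsGalois ℚ F] (hμ : IdeleClassGroup.IsConjugateSymplectic F μ)
    (ρ : muAlgValueField F μ →ₐ[ℚ] muAlgValueField F μ)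
    (hρ : ∀ x, ((ρ x : muAlgValueField F μ) : ℂ) = conj (x : ℂ))
    (h : muAlgValueField F μ ⊗[ℚ] F) (hh : Algebra.TensorProduct.map ρ (AlgHom.id ℚ F) h = h) :
    ∃ a : muAlgValueField F μ ⊗[ℚ] F, a * Algebra.TensorProduct.map ρ (AlgHom.id ℚ F) a = h := by
  classical
  haveI := hμ.numberField_muAlgValueField
  -- the reflex field `M'_μ = traceField Φ_μ ⊆ ℂ`, a CM field inside `M_μ` and inside `ι₁(F)`
  set Φ := hμ.cmType with hΦ_def
  haveI hCM : IsCMField (traceField Φ) := isCMField_traceField F Φ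
  have hle : (traceField Φ).toSubfield ≤ muAlgValueField F μ := hμ.traceField_le_muAlgValueField hμ.hasCMType_cmType
  obtain ⟨ι₁⟩ : Nonempty (F →+* ℂ) := inferInstance
  have hleF : traceField Φ ≤ ι₁.toRatAlgHom.fieldRange := traceField_le_fieldRange (AlgHom.id ℚ F) ι₁ Φ
  -- `c` = complex conjugation of `M'_μ`
  set c : traceField Φ →ₐ[ℚ] traceField Φ :=
    ((IsCMField.complexConj (traceField Φ) : traceField Φ ≃ₐ[maximalRealSubfield _] traceField Φ) :
      traceField Φ →+* traceField Φ).toRatAlgHom with hc_def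
  have hc_coe : ∀ m : traceField Φ, ((c m : traceField Φ) : ℂ) = conj (m : ℂ) := fun m =>
    IsCMField.complexEmbedding_complexConj (traceField Φ) (traceField Φ).val.toRingHom m
  have hc2 : ∀ m, c (c m) = m := fun m => IsCMField.complexConj_apply_apply (traceField Φ) m
  have hc : ∃ m, c m ≠ m := by
    obtain ⟨w, hw, hwc⟩ := NumberFields.IntermediateField.exists_mem_conj_ne_of_isCMField (traceField Φ) hCM
    refine ⟨⟨w, hw⟩, fun habs => hwc ?_⟩
    have := congrArg (fun m : traceField Φ => (m : ℂ)) habs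
    simpa [hc_coe] using this
  -- `jK : M'_μ → M_μ` (the inclusion, l. 1928) and `jE : M'_μ → F` (through `ι₁`)
  let jK' : traceField Φ →+* muAlgValueField F μ :=
    { toFun := fun m => ⟨(m : ℂ), hle m.2⟩
      map_one' := rfl
      map_mul' := fun _ _ => rfl
      map_zero' := rfl
      map_add' := fun _ _ => rfl }
  set jK : traceField Φ →ₐ[ℚ] muAlgValueField F μ := jK'.toRatAlgHom with hjK_def
  have hjK_coe : ∀ m : traceField Φ, ((jK m : muAlgValueField F μ) : ℂ) = (m : ℂ) := fun _ => rfl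
  have hρjK : ∀ m, ρ (jK m) = jK (c m) := fun m => Subtype.ext (by rw [hρ, hjK_coe, hjK_coe, hc_coe])
  have hex : ∀ m : traceField Φ, ∃ y : F, ι₁ y = (m : ℂ) := fun m => AlgHom.mem_fieldRange.mp (hleF m.2)
  choose f hf using hex
  let jE' : traceField Φ →+* F :=
    { toFun := f
      map_one' := ι₁.injective (by rw [hf]; simp)
      map_mul' := fun a b => ι₁.injective (by rw [hf, map_mul, hf, hf]; rfl)
      map_zero' := ι₁.injective (by rw [hf]; simp)
      map_add' := fun a b => ι₁.injective (by rw [hf, map_add, hf, hf]; rfl) }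
  let jE : traceField Φ →ₐ[ℚ] F := jE'.toRatAlgHom
  exact exists_mul_map_eq_of_map_eq jE c hc2 hc ρ jK hρjK h hh

/-- **The printed shape at Liu's data, every face**: for `F` a CM field Galois over `ℚ`, `μ` any conjugate symplectic
character, `ρ` complex conjugation on `M_μ`: every unit `β₀ ∈ M_μ ⊗_ℚ F` with `(ρ ⊗ 1) β₀ = -β₀` is
`(β ⊗ 1) · a · (ρ ⊗ 1) a` for EVERY `β ∈ M_μ` with `ρ β = -β`, `β ≠ 0`, `a` a unit — the normalisation asked by the
fourth bullet of Def. 4.5 (2) («there exist an element `β ∈ M_μ` …», l. 1957; «the existence of `r_μ` is obvious»,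
l. 1982) holds with ANY prescribed `β`, at primitive and non-primitive faces alike.
[cite: Liu2021, Def. 4.5 (2) fourth bullet (TeX l. 1957) and proof of Prop. 4.6 (1) (l. 1982)] -/
theorem exists_eq_tmul_mul_mul_map_muAlgValueField [IsGalois ℚ F]
    (hμ : IdeleClassGroup.IsConjugateSymplectic F μ)
    (ρ : muAlgValueField F μ →ₐ[ℚ] muAlgValueField F μ)
    (hρ : ∀ x, ((ρ x : muAlgValueField F μ) : ℂ) = conj (x : ℂ))
    (β₀ : muAlgValueField F μ ⊗[ℚ] F) (hβ₀ : IsUnit β₀)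
    (hanti : Algebra.TensorProduct.map ρ (AlgHom.id ℚ F) β₀ = -β₀)
    (β : muAlgValueField F μ) (hβ : ρ β = -β) (hβ0 : β ≠ 0) :
    ∃ a : muAlgValueField F μ ⊗[ℚ] F, IsUnit a ∧
      β₀ = (β ⊗ₜ[ℚ] (1 : F)) * a * Algebra.TensorProduct.map ρ (AlgHom.id ℚ F) a := by
  set bar := Algebra.TensorProduct.map ρ (AlgHom.id ℚ F) with hbar_def
  have hbar_tmul : ∀ (x : muAlgValueField F μ) (y : F), bar (x ⊗ₜ[ℚ] y) = ρ x ⊗ₜ[ℚ] y := fun x y => by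
    simp [hbar_def]
  set h : muAlgValueField F μ ⊗[ℚ] F := (β⁻¹ ⊗ₜ[ℚ] (1 : F)) * β₀ with hh_def
  have hh : bar h = h := by
    rw [hh_def, map_mul, hanti, hbar_tmul, map_inv₀, hβ, inv_neg, TensorProduct.neg_tmul, neg_mul_neg]
  obtain ⟨a, ha⟩ := exists_mul_map_eq_muAlgValueField hμ ρ hρ h hh
  have hββ : (β ⊗ₜ[ℚ] (1 : F)) * (β⁻¹ ⊗ₜ[ℚ] (1 : F)) = 1 := by
    rw [Algebra.TensorProduct.tmul_mul_tmul, mul_inv_cancel₀ hβ0, mul_one, Algebra.TensorProduct.one_def]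
  have hβ₀' : β₀ = (β ⊗ₜ[ℚ] (1 : F)) * a * bar a := by
    rw [mul_assoc, ha, hh_def, ← mul_assoc, hββ, one_mul]
  refine ⟨a, ?_, hβ₀'⟩
  have hu : IsUnit (a * bar a) := by
    rw [ha, hh_def]
    exact (IsUnit.of_mul_eq_one_right _ hββ).mul hβ₀
  exact isUnit_of_mul_isUnit_left hu

end Liu

end Literature.NumberTheory.Automorphic.Liu2021.Def45

end
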